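import Mathlib
import Summits.ResolutionOfSingularities.ResolutionOfSingularities.Theorems.RadicialJungCleanModelsContactChain
import Literature.AlgebraicGeometry.Resolution.Blowups
import HarnessLib

/-!
# Route `RadicialJung`, crux `CleanModels` (stmt-ResolutionOfSingularities-15917), line `Sketch` rev 35, stub 6 `stub_cleanProp44` (X44c),
# work plan O8 / L7b-global, item (G2): a chain of point blow-ups following a curve is an isomorphism away from its base point

Memo `Cruxes/CleanModels/Lines/Sketch-memo-hand2-g9-stubs-5-7.md` §3a (G2).  Along `IsPointChainAlong σ C₀ C x n` every blow-up has centre the current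
point of the chain, which lies over `σ x ∈ X₀`; so over every open `U ⊆ X₀` avoiding `σ x` the composite `σ` restricts to an isomorphism `σ⁻¹U ≅ U`
(✓ `IsBlowup.isIso_morphismRestrict`, Görtz–Wedhorn 13.91 (3), composed along `morphismRestrict_comp`).  This is the first half of «chains at distinct bad
points do not interact»; the second half (clean-permissibility is transported along `σ` over `U`) is left to the successor.

Honest framing: OURS (bookkeeping); nothing here proves X44c, resolution in characteristic `p`, or any case of `CleanModels`.
-/

noncomputable section

set_option linter.dupNamespace false -- mandated namespace of this single-conjunct summit

open CategoryTheory AlgebraicGeometry TopologicalSpace IsLocalRing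
open Literature.AlgebraicGeometry.Resolution Literature.AlgebraicGeometry.Motives
open Scheme.IdealSheafData

namespace Summit.ResolutionOfSingularities.ResolutionOfSingularities.Theorems.RadicialJung.CleanModels

universe u

/-- **A chain of point blow-ups following a curve is an isomorphism over every open avoiding its base point.**
[cite: GortzWedhorn2020, Prop. 13.91 (3)] -/
theorem IsPointChainAlong.isIso_morphismRestrict {X₀ X : Scheme.{u}} {σ : X ⟶ X₀} {C₀ : Closeds X₀} {C : Closeds X} {x : X} {n : ℕ}
    (h : IsPointChainAlong σ C₀ C x n) (U : X₀.Opens) (hU : σ x ∉ U) : IsIso (σ ∣_ U) := by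
  induction h with
  | nil C₀ x₀ => infer_instance
  | cons σ C₀ C n τ x' hx hchain hYreg hτ hx' ih =>
    have hx₀ : σ (τ x') ∉ U := by simpa using hU
    rw [morphismRestrict_comp]
    refine @IsIso.comp_isIso _ _ _ _ _ _ _ ?_ (ih hx₀)
    refine hτ.isIso_morphismRestrict ?_
    rw [Scheme.IdealSheafData.coe_support_vanishingIdeal]
    exact Set.disjoint_singleton_right.mpr hx₀

end Summit.ResolutionOfSingularities.ResolutionOfSingularities.Theorems.RadicialJung.CleanModels

end
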